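/-
Copyright (c) 2026 the pub-hodgecm-mathlib formalisation cell (harness21).  Prover seat hodgecm-mathlib-LH4-p08 (g7), req620 Track A «(D-RAM) FOUR-FRAME» squad, helper lane
on h413 = stmt-HodgeConjecture-24833 (count-neutral).  STAGE-1b typed inventory (heir LEAD F0P3a-plan (g20) T19-24): the G-side of ROW (3) for a GENERIC piece.  2026-09-04.
-/
import Literature.NumberTheory.Automorphic.UnitaryGroupTorusOrbitalIntegralCanonical   -- ★ S0 «CONVENTIONS JOINT» FILE 2 (F0P3b-p01 (g7)): `classOrbitalIntegral_eq_smul_integral_prod_of_torus_regular` (general Borel φ, constant explicit)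
import HarnessLib

/-!
# The canonical orbital integral of an `Ad K`-INVARIANT test function at a regular split-torus class: the `K`-average collapses, and a piece that is
# LEFT-INVARIANT under the (deep) torus element is the UNIT times its UNIPOTENT-FIBRE VOLUME — division-free ratio form
(Rogawski (1990), §4.9 Prop. 4.9.1 (b), (4.9.2) p. 55 «`Φ(γ, f) = |D(γ)|⁻¹ f^{(B)}(γ)`»; §4.13 Lemma 4.13.1 (a) p. 64 and its proof p. 70 «`dg = dk dm du`»; §4.3 (4.3.1))

Topic `NumberTheory/Automorphic`; namespace `Literature.NumberTheory.Automorphic.UnitaryGroup`.  KERNEL mathematics only: theorems, no definition, no named fact,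
no instance, no notation, no `sorry`.  Cell `pub/hodgecm-mathlib`, crux H413 = `stmt-HodgeConjecture-24833`, Track A «(D-RAM) FOUR-FRAME», STAGE-1b typed inventory
(heir LEAD F0P3a-plan (g20) T19-24 «pre-scoping by idle hands: allowed»; dealer LH4-plan (g12) board), seat LH4-p08 (g7).  HONEST LABEL: HC_CM is proved only modulo the
7 printed citations (2 remaining named inputs: hLiu418 = `stmt-HodgeConjecture-24832`, h413 = `stmt-HodgeConjecture-24833`) until rung 0 closes; this file discharges no named
fact and pays no registered stub.

THE POINT.  The three open tier-0 rows of the four-frame line (`stub_rows_transvPlus ∕ transvMinus ∕ regular`) each carry a ROW (3) — the LEVI population (`γ_H` conjugate in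
`H_v` to a diagonal element): its norm pairs in `G = U(Φ₃)(L⁺_v)` are the classes of REGULAR SPLIT-TORUS elements `t = diag(d)`, DEEP (`t → 1` as `γ_H → 1`).  ★ S0 FILE 2
`classOrbitalIntegral_eq_smul_integral_prod_of_torus_regular` computes the canonical orbital integral of ANY Borel `φ` there in Iwasawa coordinates:
`Φ(⟦e t⟧, φ) = (X · J₃(t)).toReal • ∫_{K × N} φ(e(k (t n) k⁻¹)) d(κ ⊗ μ_N)` (`e` the congruence frame `U(Φ₃)_v ≃ U(H)_v`, `X = νG(e K) ∕ (κ(K) μ_N(N ∩ K))`).  The STAGE-1b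
pieces `f = 𝟙{u ∈ K | P(ι_w u − 1)}` are `Ad K`-INVARIANT and LEFT-INVARIANT under the congruence set `K(ϖ_w^{m*})` (★ `piecePropsWild_*`, unit U4), which contains `t` once
`γ_H` is near enough to `1`.  For such `φ`:
* `Ad K`-invariance (`φ(e(k x k⁻¹)) = φ(e x)`, `k ∈ K`) collapses the `K`-average: `∫_{K × N} φ(e(k (t n) k⁻¹)) = κ(K) • ∫_N φ(e(t n))` (`integral_fun_snd`);
* left-invariance under `t` (`φ(e(t x)) = φ(e x)`) removes `t`: `= κ(K) • ∫_N φ(e n)` — the UNIPOTENT-FIBRE VOLUME of the piece (its constant term at `1`);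
* hence for TWO such functions `φ, φ′` the DIVISION-FREE RATIO `Φ(⟦e t⟧, φ) · ∫_N φ′(e n) = Φ(⟦e t⟧, φ′) · ∫_N φ(e n)`: with `φ′ = 1_K` (the anchor, whose row (3) is ★ p855650 ∕
  ★ `stableOrbitalIntegralRel_indicator_eq_finsum_delta_of_levi_antidiagOne`) every STAGE-1b piece is, on the Levi stratum, THE UNIT TIMES ITS FIBRE-VOLUME FRACTION
  `ρ_P = μ_N{n ∈ N ∩ K | P(n − 1)} ∕ μ_N(N ∩ K)` — one generic file + one elementary fibre-volume evaluation per piece, no census.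

WHAT IS PROVED (all over ★ S0 FILE 2's binders VERBATIM; `e = cmDatumLocalCongr L v T ha h`, ANY non-split place, ANY hermitian `H` congruent to `a • Φ₃`).
* §1 `integral_prod_eq_real_smul_integral_of_eq_comp_snd` — the product-measure collapse for an integrand that factors through the second variable (generic).
* §2 `classOrbitalIntegral_eq_smul_integral_unipotent_of_conj_invariant` — `Φ(⟦e t⟧, φ) = (X·J₃(t)).toReal • (κ(K) • ∫_N φ(e(t n)) dμ_N)` for `Ad K`-invariant `φ`.
* §3 `classOrbitalIntegral_eq_smul_integral_unipotent_of_conj_invariant_of_left_invariant` — `… = (X·J₃(t)).toReal • (κ(K) • ∫_N φ(e n) dμ_N)` if moreover `φ(e(t x)) = φ(e x)`.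
* §4 `classOrbitalIntegral_mul_integral_eq_of_conj_invariant_of_left_invariant` — the division-free ratio for two such functions (the consumer takes `φ′ = 1_K`).

## References
* [Rogawski1990] J. D. Rogawski, *Automorphic Representations of Unitary Groups in Three Variables*, Ann. of Math. Stud. 123 (1990), §4.9 Prop. 4.9.1 (b), (4.9.2)
  p. 55; §4.13 Lemma 4.13.1 (a) p. 64, proof p. 70; §4.3 (4.3.1) p. 43.
* [DeitmarEchterhoff2014] A. Deitmar, S. Echterhoff, *Principles of Harmonic Analysis*, 2nd ed. (2014), Thm. 1.5.3.
* [CartierCorvallis1979] P. Cartier, *Representations of 𝔭-adic groups: a survey*, PSPM 33.1 (1979), §IV (4.2) (constant terms).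
-/

set_option autoImplicit false

noncomputable section

open MeasureTheory Measure Set Filter Topology NumberField IsDedekindDomain
open Literature.MeasureTheory.Group
open scoped ENNReal NNReal Matrix MatrixGroups

namespace Literature.NumberTheory.Automorphic.UnitaryGroup

open Literature.NumberTheory.Rogawski1990 (IsRegularElt)
open Literature.NumberTheory.Automorphic

/-! ## §1  The product-measure collapse -/

/-- If an integrand on `X × Y` factors through the second variable, its integral against `κ ⊗ μ` is `κ(X) • ∫_Y` (s-finite measures; `integral_fun_snd`).
[cite: DeitmarEchterhoff2014, Thm. 1.5.3] -/
theorem integral_prod_eq_real_smul_integral_of_eq_comp_snd {X Y : Type*} [MeasurableSpace X] [MeasurableSpace Y]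
    (κ : Measure X) (μ : Measure Y) [SFinite κ] [SFinite μ] (F : X × Y → ℂ) (g : Y → ℂ) (hF : ∀ p, F p = g p.2) :
    ∫ p, F p ∂(κ.prod μ) = κ.real univ • ∫ y, g y ∂μ := by
  rw [show F = fun p : X × Y => g p.2 from funext hF]
  exact integral_fun_snd g

/-! ## §2  `Ad K`-invariant test functions: the `K`-average collapses -/

set_option maxHeartbeats 800000 in
-- statement-heavy (the ★ S0 FILE 2 binder block); the proof is one rewrite + §1
/-- **THE CANONICAL ORBITAL INTEGRAL OF AN `Ad K`-INVARIANT TEST FUNCTION AT A REGULAR SPLIT-TORUS CLASS.**  ★ S0 FILE 2's binders VERBATIM (any non-split place, any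
hermitian `H` congruent to `a • Φ₃` by `T`, frame `e = cmDatumLocalCongr L v T ha h`, ANY Haar `νG`, CANONICAL `mG`, the hyperspecial `K` of `U(Φ₃)(L⁺_v)`, Haar `κ`, `μ_N`,
REGULAR diagonal `t`), plus s-finiteness of `κ`, `μ_N` and `Ad K`-INVARIANCE of `φ ∘ e` (`hconj`): the `K`-average collapses,
`Φ(⟦e t⟧, φ) = (X · J₃(t)).toReal • (κ(K) • ∫_N φ(e(t n)) dμ_N)`. [cite: Rogawski1990, §4.9 Prop. 4.9.1 (b), (4.9.2) p. 55; §4.13 Lemma 4.13.1 (a) p. 64 and p. 70]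
[cite: DeitmarEchterhoff2014, Thm. 1.5.3] -/
theorem classOrbitalIntegral_eq_smul_integral_unipotent_of_conj_invariant
    (L : Type) [Field L] [NumberField L] [IsCMField L] (H : Matrix (Fin 3) (Fin 3) L)
    (hH : (H.map (IsCMField.complexConj L))ᵀ = H) (hHd : IsUnit H.det)
    {v : HeightOneSpectrum (𝓞 ↥(maximalRealSubfield L))} (w : PlacesOver L v) (hw : IsCMField.complexConj L • w.1 = w.1)
    (T : GL (Fin 3) (LocalRing L v)) {a : LocalRing L v} (ha : IsUnit a)
    (h : formCongr (conjLocal L (IsCMField.complexConj L) v) T (H.map (algebraMap L (LocalRing L v))) =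
      a • (Matrix.of fun i j : Fin 3 => if i.val + j.val + 1 = 3 then (1 : L) else 0).map (algebraMap L (LocalRing L v)))
    [MeasurableSpace ((cmDatum L 3 H).Local v)] [BorelSpace ((cmDatum L 3 H).Local v)]
    [∀ γ : (cmDatum L 3 H).Local v, MeasurableSpace (((cmDatum L 3 H).Local v) ⧸ Subgroup.centralizer ({γ} : Set ((cmDatum L 3 H).Local v)))]
    [∀ γ : (cmDatum L 3 H).Local v, BorelSpace (((cmDatum L 3 H).Local v) ⧸ Subgroup.centralizer ({γ} : Set ((cmDatum L 3 H).Local v)))]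
    (νG : Measure ((cmDatum L 3 H).Local v)) [νG.IsHaarMeasure] [νG.IsMulRightInvariant]
    {mG : OrbitalMeasureFamily ((cmDatum L 3 H).Local v)}
    (hmG : mG.IsCanonical (fun γ => IsRegularElt (γ.val : GL (Fin 3) (LocalRing L v))) νG)
    [MeasurableSpace ↥(unitaryGroupOfForm (conjLocal L (IsCMField.complexConj L) v) (cmLocalForm L 3 v))]
    [BorelSpace ↥(unitaryGroupOfForm (conjLocal L (IsCMField.complexConj L) v) (cmLocalForm L 3 v))]
    {K : Subgroup ↥(unitaryGroupOfForm (conjLocal L (IsCMField.complexConj L) v) (cmLocalForm L 3 v))}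
    (hKv : ∀ g : ↥(unitaryGroupOfForm (conjLocal L (IsCMField.complexConj L) v) (cmLocalForm L 3 v)),
      g ∈ K ↔ g ∈ cmLocalIntegralLevel L 3 (Matrix.of fun i j : Fin 3 => if i.val + j.val + 1 = 3 then (1 : L) else 0) v)
    (κ : Measure ↥K) [κ.IsHaarMeasure]
    (μN : Measure ↥(unipotentU (conjLocal L (IsCMField.complexConj L) v) (cmLocalForm L 3 v))) [μN.IsHaarMeasure]
    (t : ↥(torusU (conjLocal L (IsCMField.complexConj L) v) (cmLocalForm L 3 v))) {d : Fin 3 → (LocalRing L v)ˣ}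
    (hd : glDiagonal 3 (LocalRing L v) d =
      ((t : ↥(unitaryGroupOfForm (conjLocal L (IsCMField.complexConj L) v) (cmLocalForm L 3 v))) : GL (Fin 3) (LocalRing L v)))
    (hreg : ∀ i j, i ≠ j → IsUnit ((d i : LocalRing L v) - d j))
    (ha' : IsUnit ((((d 0)⁻¹ * d 1 : (LocalRing L v)ˣ) : LocalRing L v) - 1))
    (hb' : IsUnit ((((d 0)⁻¹ * d 2 : (LocalRing L v)ˣ) : LocalRing L v) - 1))
    [SFinite κ] [SFinite μN]
    {φ : (cmDatum L 3 H).Local v → ℂ} (hφ : Measurable φ)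
    (hconj : ∀ (k : ↥K) (x : ↥(unitaryGroupOfForm (conjLocal L (IsCMField.complexConj L) v) (cmLocalForm L 3 v))), φ (cmDatumLocalCongr L v T ha h ((k : ↥(unitaryGroupOfForm (conjLocal L (IsCMField.complexConj L) v) (cmLocalForm L 3 v))) * x * (k : ↥(unitaryGroupOfForm (conjLocal L (IsCMField.complexConj L) v) (cmLocalForm L 3 v)))⁻¹)) = φ (cmDatumLocalCongr L v T ha h x)) :
    classOrbitalIntegral mG φ (ConjClasses.mk (cmDatumLocalCongr L v T ha h (t : ↥(unitaryGroupOfForm (conjLocal L (IsCMField.complexConj L) v) (cmLocalForm L 3 v))))) =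
      ((νG ((cmDatumLocalCongr L v T ha h).symm ⁻¹' (K : Set ↥(unitaryGroupOfForm (conjLocal L (IsCMField.complexConj L) v) (cmLocalForm L 3 v))))) /
            (κ univ * μN {n | (n : ↥(unitaryGroupOfForm (conjLocal L (IsCMField.complexConj L) v) (cmLocalForm L 3 v))) ∈ K}) *
          ((letI : MeasurableSpace (LocalRing L v) := borel _; haveI : BorelSpace (LocalRing L v) := ⟨rfl⟩
          haveI : SecondCountableTopology (LocalRing L v) := secondCountableTopology_localRing (E := L) v
          ((distribHaarChar (LocalRing L v) ha'.unit)⁻¹ *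
            (HeisRing.skewModulus (conjLocal L (IsCMField.complexConj L) v) (continuous_conjLocal L (IsCMField.complexConj L) v) hb'.unit
              (HeisRing.map_unit_torusCentralScalar_sub_one (conjLocal L (IsCMField.complexConj L) v) (cmLocalForm_eq_over L 3 v) t hd hb'))⁻¹ :
                ℝ≥0)) : ℝ≥0∞)).toReal •
        ((κ.real univ) • ∫ n : ↥(unipotentU (conjLocal L (IsCMField.complexConj L) v) (cmLocalForm L 3 v)), φ (cmDatumLocalCongr L v T ha h ((t : ↥(unitaryGroupOfForm (conjLocal L (IsCMField.complexConj L) v) (cmLocalForm L 3 v))) * (n : ↥(unitaryGroupOfForm (conjLocal L (IsCMField.complexConj L) v) (cmLocalForm L 3 v))))) ∂μN) := by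
  rw [classOrbitalIntegral_eq_smul_integral_prod_of_torus_regular L H hH hHd w hw T ha h νG hmG hKv κ μN t hd hreg ha' hb' hφ,
    integral_prod_eq_real_smul_integral_of_eq_comp_snd κ μN _ (fun n : ↥(unipotentU (conjLocal L (IsCMField.complexConj L) v) (cmLocalForm L 3 v)) => φ (cmDatumLocalCongr L v T ha h ((t : ↥(unitaryGroupOfForm (conjLocal L (IsCMField.complexConj L) v) (cmLocalForm L 3 v))) * (n : ↥(unitaryGroupOfForm (conjLocal L (IsCMField.complexConj L) v) (cmLocalForm L 3 v)))))) (fun p => hconj p.1 _)]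

/-! ## §3  … and LEFT-INVARIANT under the torus element: the unipotent-fibre volume -/

set_option maxHeartbeats 800000 in
-- statement-heavy; proof = §2 + one rewrite under the integral
/-- **A PIECE LEFT-INVARIANT UNDER THE (DEEP) TORUS ELEMENT IS ITS UNIPOTENT-FIBRE VOLUME ON THE LEVI STRATUM.**  Under the hypotheses of
`classOrbitalIntegral_eq_smul_integral_unipotent_of_conj_invariant` and left-invariance `φ(e(t x)) = φ(e x)` (`hleft`; for the STAGE-1b pieces this is the left-`K(ϖ_w^{m*})`
clause of ★ `piecePropsWild_*` once `t ∈ K(ϖ_w^{m*})`, i.e. `γ_H` near `1`): `Φ(⟦e t⟧, φ) = (X · J₃(t)).toReal • (κ(K) • ∫_N φ(e n) dμ_N)` — the constant term of `φ` at `1`.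
[cite: Rogawski1990, §4.9 Prop. 4.9.1 (b), (4.9.2) p. 55; §4.13 p. 70] [cite: CartierCorvallis1979, §IV (4.2)] -/
theorem classOrbitalIntegral_eq_smul_integral_unipotent_of_conj_invariant_of_left_invariant
    (L : Type) [Field L] [NumberField L] [IsCMField L] (H : Matrix (Fin 3) (Fin 3) L)
    (hH : (H.map (IsCMField.complexConj L))ᵀ = H) (hHd : IsUnit H.det)
    {v : HeightOneSpectrum (𝓞 ↥(maximalRealSubfield L))} (w : PlacesOver L v) (hw : IsCMField.complexConj L • w.1 = w.1)
    (T : GL (Fin 3) (LocalRing L v)) {a : LocalRing L v} (ha : IsUnit a)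
    (h : formCongr (conjLocal L (IsCMField.complexConj L) v) T (H.map (algebraMap L (LocalRing L v))) =
      a • (Matrix.of fun i j : Fin 3 => if i.val + j.val + 1 = 3 then (1 : L) else 0).map (algebraMap L (LocalRing L v)))
    [MeasurableSpace ((cmDatum L 3 H).Local v)] [BorelSpace ((cmDatum L 3 H).Local v)]
    [∀ γ : (cmDatum L 3 H).Local v, MeasurableSpace (((cmDatum L 3 H).Local v) ⧸ Subgroup.centralizer ({γ} : Set ((cmDatum L 3 H).Local v)))]
    [∀ γ : (cmDatum L 3 H).Local v, BorelSpace (((cmDatum L 3 H).Local v) ⧸ Subgroup.centralizer ({γ} : Set ((cmDatum L 3 H).Local v)))]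
    (νG : Measure ((cmDatum L 3 H).Local v)) [νG.IsHaarMeasure] [νG.IsMulRightInvariant]
    {mG : OrbitalMeasureFamily ((cmDatum L 3 H).Local v)}
    (hmG : mG.IsCanonical (fun γ => IsRegularElt (γ.val : GL (Fin 3) (LocalRing L v))) νG)
    [MeasurableSpace ↥(unitaryGroupOfForm (conjLocal L (IsCMField.complexConj L) v) (cmLocalForm L 3 v))]
    [BorelSpace ↥(unitaryGroupOfForm (conjLocal L (IsCMField.complexConj L) v) (cmLocalForm L 3 v))]
    {K : Subgroup ↥(unitaryGroupOfForm (conjLocal L (IsCMField.complexConj L) v) (cmLocalForm L 3 v))}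
    (hKv : ∀ g : ↥(unitaryGroupOfForm (conjLocal L (IsCMField.complexConj L) v) (cmLocalForm L 3 v)),
      g ∈ K ↔ g ∈ cmLocalIntegralLevel L 3 (Matrix.of fun i j : Fin 3 => if i.val + j.val + 1 = 3 then (1 : L) else 0) v)
    (κ : Measure ↥K) [κ.IsHaarMeasure]
    (μN : Measure ↥(unipotentU (conjLocal L (IsCMField.complexConj L) v) (cmLocalForm L 3 v))) [μN.IsHaarMeasure]
    (t : ↥(torusU (conjLocal L (IsCMField.complexConj L) v) (cmLocalForm L 3 v))) {d : Fin 3 → (LocalRing L v)ˣ}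
    (hd : glDiagonal 3 (LocalRing L v) d =
      ((t : ↥(unitaryGroupOfForm (conjLocal L (IsCMField.complexConj L) v) (cmLocalForm L 3 v))) : GL (Fin 3) (LocalRing L v)))
    (hreg : ∀ i j, i ≠ j → IsUnit ((d i : LocalRing L v) - d j))
    (ha' : IsUnit ((((d 0)⁻¹ * d 1 : (LocalRing L v)ˣ) : LocalRing L v) - 1))
    (hb' : IsUnit ((((d 0)⁻¹ * d 2 : (LocalRing L v)ˣ) : LocalRing L v) - 1))
    [SFinite κ] [SFinite μN]
    {φ : (cmDatum L 3 H).Local v → ℂ} (hφ : Measurable φ)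
    (hconj : ∀ (k : ↥K) (x : ↥(unitaryGroupOfForm (conjLocal L (IsCMField.complexConj L) v) (cmLocalForm L 3 v))), φ (cmDatumLocalCongr L v T ha h ((k : ↥(unitaryGroupOfForm (conjLocal L (IsCMField.complexConj L) v) (cmLocalForm L 3 v))) * x * (k : ↥(unitaryGroupOfForm (conjLocal L (IsCMField.complexConj L) v) (cmLocalForm L 3 v)))⁻¹)) = φ (cmDatumLocalCongr L v T ha h x))
    (hleft : ∀ x : ↥(unitaryGroupOfForm (conjLocal L (IsCMField.complexConj L) v) (cmLocalForm L 3 v)), φ (cmDatumLocalCongr L v T ha h ((t : ↥(unitaryGroupOfForm (conjLocal L (IsCMField.complexConj L) v) (cmLocalForm L 3 v))) * x)) = φ (cmDatumLocalCongr L v T ha h x)) :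
    classOrbitalIntegral mG φ (ConjClasses.mk (cmDatumLocalCongr L v T ha h (t : ↥(unitaryGroupOfForm (conjLocal L (IsCMField.complexConj L) v) (cmLocalForm L 3 v))))) =
      ((νG ((cmDatumLocalCongr L v T ha h).symm ⁻¹' (K : Set ↥(unitaryGroupOfForm (conjLocal L (IsCMField.complexConj L) v) (cmLocalForm L 3 v))))) /
            (κ univ * μN {n | (n : ↥(unitaryGroupOfForm (conjLocal L (IsCMField.complexConj L) v) (cmLocalForm L 3 v))) ∈ K}) *
          ((letI : MeasurableSpace (LocalRing L v) := borel _; haveI : BorelSpace (LocalRing L v) := ⟨rfl⟩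
          haveI : SecondCountableTopology (LocalRing L v) := secondCountableTopology_localRing (E := L) v
          ((distribHaarChar (LocalRing L v) ha'.unit)⁻¹ *
            (HeisRing.skewModulus (conjLocal L (IsCMField.complexConj L) v) (continuous_conjLocal L (IsCMField.complexConj L) v) hb'.unit
              (HeisRing.map_unit_torusCentralScalar_sub_one (conjLocal L (IsCMField.complexConj L) v) (cmLocalForm_eq_over L 3 v) t hd hb'))⁻¹ :
                ℝ≥0)) : ℝ≥0∞)).toReal •
        ((κ.real univ) • ∫ n : ↥(unipotentU (conjLocal L (IsCMField.complexConj L) v) (cmLocalForm L 3 v)), φ (cmDatumLocalCongr L v T ha h (n : ↥(unitaryGroupOfForm (conjLocal L (IsCMField.complexConj L) v) (cmLocalForm L 3 v)))) ∂μN) := by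
  rw [classOrbitalIntegral_eq_smul_integral_unipotent_of_conj_invariant L H hH hHd w hw T ha h νG hmG hKv κ μN t hd hreg ha' hb' hφ hconj]
  simp_rw [hleft]

/-! ## §4  The division-free ratio of two such functions (consumer: `φ′ = 1_K`, the anchor) -/

set_option maxHeartbeats 800000 in
-- statement-heavy; proof = two instances of §3 + `ring`-level algebra on scalars
/-- **ON THE LEVI STRATUM EVERY `Ad K`-INVARIANT, `t`-LEFT-INVARIANT PIECE IS PROPORTIONAL TO ANY OTHER, IN THE RATIO OF THEIR UNIPOTENT-FIBRE VOLUMES** — division-free: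
`Φ(⟦e t⟧, φ) · ∫_N φ′(e n) dμ_N = Φ(⟦e t⟧, φ′) · ∫_N φ(e n) dμ_N`.  With `φ′ = 1_K` (row (3) of the anchor: ★ `stableOrbitalIntegralRel_indicator_eq_finsum_delta_of_levi_antidiagOne`,
★ p855650) this is row (3)'s G-side for every STAGE-1b piece: the unit times the fibre-volume fraction `ρ = ∫_N φ(e n) ∕ μ_N(N ∩ K)`.
[cite: Rogawski1990, §4.9 Prop. 4.9.1 (b), (4.9.2) p. 55; §4.3 (4.3.1) p. 43] [cite: CartierCorvallis1979, §IV (4.2)] -/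
theorem classOrbitalIntegral_mul_integral_eq_of_conj_invariant_of_left_invariant
    (L : Type) [Field L] [NumberField L] [IsCMField L] (H : Matrix (Fin 3) (Fin 3) L)
    (hH : (H.map (IsCMField.complexConj L))ᵀ = H) (hHd : IsUnit H.det)
    {v : HeightOneSpectrum (𝓞 ↥(maximalRealSubfield L))} (w : PlacesOver L v) (hw : IsCMField.complexConj L • w.1 = w.1)
    (T : GL (Fin 3) (LocalRing L v)) {a : LocalRing L v} (ha : IsUnit a)
    (h : formCongr (conjLocal L (IsCMField.complexConj L) v) T (H.map (algebraMap L (LocalRing L v))) =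
      a • (Matrix.of fun i j : Fin 3 => if i.val + j.val + 1 = 3 then (1 : L) else 0).map (algebraMap L (LocalRing L v)))
    [MeasurableSpace ((cmDatum L 3 H).Local v)] [BorelSpace ((cmDatum L 3 H).Local v)]
    [∀ γ : (cmDatum L 3 H).Local v, MeasurableSpace (((cmDatum L 3 H).Local v) ⧸ Subgroup.centralizer ({γ} : Set ((cmDatum L 3 H).Local v)))]
    [∀ γ : (cmDatum L 3 H).Local v, BorelSpace (((cmDatum L 3 H).Local v) ⧸ Subgroup.centralizer ({γ} : Set ((cmDatum L 3 H).Local v)))]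
    (νG : Measure ((cmDatum L 3 H).Local v)) [νG.IsHaarMeasure] [νG.IsMulRightInvariant]
    {mG : OrbitalMeasureFamily ((cmDatum L 3 H).Local v)}
    (hmG : mG.IsCanonical (fun γ => IsRegularElt (γ.val : GL (Fin 3) (LocalRing L v))) νG)
    [MeasurableSpace ↥(unitaryGroupOfForm (conjLocal L (IsCMField.complexConj L) v) (cmLocalForm L 3 v))]
    [BorelSpace ↥(unitaryGroupOfForm (conjLocal L (IsCMField.complexConj L) v) (cmLocalForm L 3 v))]
    {K : Subgroup ↥(unitaryGroupOfForm (conjLocal L (IsCMField.complexConj L) v) (cmLocalForm L 3 v))}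
    (hKv : ∀ g : ↥(unitaryGroupOfForm (conjLocal L (IsCMField.complexConj L) v) (cmLocalForm L 3 v)),
      g ∈ K ↔ g ∈ cmLocalIntegralLevel L 3 (Matrix.of fun i j : Fin 3 => if i.val + j.val + 1 = 3 then (1 : L) else 0) v)
    (κ : Measure ↥K) [κ.IsHaarMeasure]
    (μN : Measure ↥(unipotentU (conjLocal L (IsCMField.complexConj L) v) (cmLocalForm L 3 v))) [μN.IsHaarMeasure]
    (t : ↥(torusU (conjLocal L (IsCMField.complexConj L) v) (cmLocalForm L 3 v))) {d : Fin 3 → (LocalRing L v)ˣ}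
    (hd : glDiagonal 3 (LocalRing L v) d =
      ((t : ↥(unitaryGroupOfForm (conjLocal L (IsCMField.complexConj L) v) (cmLocalForm L 3 v))) : GL (Fin 3) (LocalRing L v)))
    (hreg : ∀ i j, i ≠ j → IsUnit ((d i : LocalRing L v) - d j))
    (ha' : IsUnit ((((d 0)⁻¹ * d 1 : (LocalRing L v)ˣ) : LocalRing L v) - 1))
    (hb' : IsUnit ((((d 0)⁻¹ * d 2 : (LocalRing L v)ˣ) : LocalRing L v) - 1))
    [SFinite κ] [SFinite μN]
    {φ φ' : (cmDatum L 3 H).Local v → ℂ} (hφ : Measurable φ) (hφ' : Measurable φ')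
    (hconj : ∀ (k : ↥K) (x : ↥(unitaryGroupOfForm (conjLocal L (IsCMField.complexConj L) v) (cmLocalForm L 3 v))), φ (cmDatumLocalCongr L v T ha h ((k : ↥(unitaryGroupOfForm (conjLocal L (IsCMField.complexConj L) v) (cmLocalForm L 3 v))) * x * (k : ↥(unitaryGroupOfForm (conjLocal L (IsCMField.complexConj L) v) (cmLocalForm L 3 v)))⁻¹)) = φ (cmDatumLocalCongr L v T ha h x))
    (hleft : ∀ x : ↥(unitaryGroupOfForm (conjLocal L (IsCMField.complexConj L) v) (cmLocalForm L 3 v)), φ (cmDatumLocalCongr L v T ha h ((t : ↥(unitaryGroupOfForm (conjLocal L (IsCMField.complexConj L) v) (cmLocalForm L 3 v))) * x)) = φ (cmDatumLocalCongr L v T ha h x))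
    (hconj' : ∀ (k : ↥K) (x : ↥(unitaryGroupOfForm (conjLocal L (IsCMField.complexConj L) v) (cmLocalForm L 3 v))), φ' (cmDatumLocalCongr L v T ha h ((k : ↥(unitaryGroupOfForm (conjLocal L (IsCMField.complexConj L) v) (cmLocalForm L 3 v))) * x * (k : ↥(unitaryGroupOfForm (conjLocal L (IsCMField.complexConj L) v) (cmLocalForm L 3 v)))⁻¹)) = φ' (cmDatumLocalCongr L v T ha h x))
    (hleft' : ∀ x : ↥(unitaryGroupOfForm (conjLocal L (IsCMField.complexConj L) v) (cmLocalForm L 3 v)), φ' (cmDatumLocalCongr L v T ha h ((t : ↥(unitaryGroupOfForm (conjLocal L (IsCMField.complexConj L) v) (cmLocalForm L 3 v))) * x)) = φ' (cmDatumLocalCongr L v T ha h x)) :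
    classOrbitalIntegral mG φ (ConjClasses.mk (cmDatumLocalCongr L v T ha h (t : ↥(unitaryGroupOfForm (conjLocal L (IsCMField.complexConj L) v) (cmLocalForm L 3 v))))) * ∫ n : ↥(unipotentU (conjLocal L (IsCMField.complexConj L) v) (cmLocalForm L 3 v)), φ' (cmDatumLocalCongr L v T ha h (n : ↥(unitaryGroupOfForm (conjLocal L (IsCMField.complexConj L) v) (cmLocalForm L 3 v)))) ∂μN =
      classOrbitalIntegral mG φ' (ConjClasses.mk (cmDatumLocalCongr L v T ha h (t : ↥(unitaryGroupOfForm (conjLocal L (IsCMField.complexConj L) v) (cmLocalForm L 3 v))))) * ∫ n : ↥(unipotentU (conjLocal L (IsCMField.complexConj L) v) (cmLocalForm L 3 v)), φ (cmDatumLocalCongr L v T ha h (n : ↥(unitaryGroupOfForm (conjLocal L (IsCMField.complexConj L) v) (cmLocalForm L 3 v)))) ∂μN := by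
  rw [classOrbitalIntegral_eq_smul_integral_unipotent_of_conj_invariant_of_left_invariant L H hH hHd w hw T ha h νG hmG hKv κ μN t hd hreg ha' hb' hφ hconj hleft,
    classOrbitalIntegral_eq_smul_integral_unipotent_of_conj_invariant_of_left_invariant L H hH hHd w hw T ha h νG hmG hKv κ μN t hd hreg ha' hb' hφ' hconj' hleft']
  simp only [Complex.real_smul]
  ring

end Literature.NumberTheory.Automorphic.UnitaryGroup

end
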